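/-
Copyright (c) 2026 the pub-hodgecm-mathlib formalisation cell (harness21).  Prover seat hodgecm-mathlib-LH4-p03 (g5), 2026-09-02: «DISCRIMINANT = DIFFERENT + 2·CONDUCTOR for the
monogenic orders `𝒪_v[x]`» (F0P3a-p06 (g18) SEAM DEAL #2 (A)).
-/
import Literature.NumberTheory.Automorphic.RamifiedPlaceSigmaDepth          -- ★ p850961 (F0P3a-p06 (g18)): `valued_galAdicCompletionMap_sub_self_le_sq_mul_iff`, `…_le_iff_mem_order`; brings ★ p850872 `RamifiedPlaceDifferent` + ★ basis
import Literature.NumberTheory.Automorphic.RamifiedPlaceDifferentConductor   -- ★ p850893 (F0P3a-p06 (g18)): `toPlace_trace_sq_add_four_mul_eq` (`ι(u₀² + 4v₀) = (τ − στ)²`)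
import HarnessLib

/-!
# The discriminant of a monogenic order at a ramified CM place: `ord_v disc(x) = d + 2·j(x)`, and `𝒪_v[x]` IS the conductor-`j(x)` order
# (`x = ι p + ι q τ ∈ 𝒪_w`, `j(x) = ord_v q`; Serre, *Local Fields* III §6, IV §1; Neukirch I §12)

Topic `NumberTheory/Automorphic`; namespace `Literature.NumberTheory.Automorphic.UnitaryGroup`.  THEOREMS ONLY (no definition, no instance, no notation, no named fact,
no `sorry`; axioms ⊆ {propext, Classical.choice, Quot.sound}).  Cell `pub/hodgecm-mathlib` (D-0151), crux H413 = `stmt-HodgeConjecture-24833`; half A line LH4, DYADIC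
pay-down leaf `Cruxes/H413/Lines/F0_P3c_DyadicPaydown.lean`, organ (D-RAM) (PRINT by ruling D74′; SCOPE-AUDIT b4c76626: COVERED at `v ∣ 2`).  HONEST READER LABEL: banked base
layer for mechanism M4 of the `DUNR-H2-CENSUS` (wild self-dual cyclic lattice laws, keyed on the CONDUCTOR of `𝒪_w[γ]`); consumers: none live; count-neutral.  HC_CM is proved only
modulo the 7 printed citations (2 remaining named inputs: hLiu418 = stmt-HodgeConjecture-24832, h413 = stmt-HodgeConjecture-24833) until rung 0 closes.

SETTING (= ★ `RamifiedPlaceDifferent`).  `L` CM, `w ∣ v` ramified, `ι = toPlace v w`, `σ = σ_w`, `τ` a uniformiser of `L_w` with Eisenstein data `τ + στ = ι u₀`, `τ·στ = −ι v₀`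
(★ `exists_eisenstein_coeffs_of_ramified`), `D := |στ − τ|_w = exp(−d)` the different number.  An element of `𝒪_w` is `x = ι p + ι q·τ` with `p, q ∈ 𝒪_v` (★ basis); its
«conductor» is `j(x) := ord_v q` and its «discriminant» is the `σ`-fixed square `(x − σx)² ∈ ι(L⁺_v)`.
* §1 (D1) `x − σx = ι q·(τ − στ)` (`sub_galAdicCompletionMap_toPlace_add_toPlace_mul`), hence **`sub_galAdicCompletionMap_sq_eq_toPlace`**: `(x − σx)² = ι(q²·(u₀² + 4v₀))` (★
  `toPlace_trace_sq_add_four_mul_eq`), **`valued_sub_galAdicCompletionMap_sq`**: `|(x − σx)²|_w = |q|⁴·D²`, `valued_trace_sq_add_four_mul`: `|u₀² + 4v₀|_v = D` (the different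
  number read in `L⁺_v`-letters — both valuations normalised, ★ FILE 2's convention), and **`exists_toPlace_eq_sub_galAdicCompletionMap_sq`**: `∃ δ ∈ L⁺_v, ι δ = (x − σx)² ∧ |δ|_v =
  |q|_v²·D` — «ord_v disc(x) = 2·j(x) + d», with the conductor-letter dress `…_of_valued_eq_exp_neg` (`|q| = exp(−j)`, `D = exp(−d)` ⇒ `|δ| = exp(−(d + 2j))`).
* §2 (D2) **`mem_order_iff_valued_galAdicCompletionMap_sub_self_le`**: `y ∈ 𝒪_v[x]` (i.e. `y = ι a + ι b·x`, `a, b ∈ 𝒪_v`) **iff** `|y| ≤ 1 ∧ |σy − y| ≤ |q|²·D` — the monogenic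
  order `𝒪_v[x]` IS the σ-depth ball of radius `|q|²·D` in `𝒪_w`, which by ★ σ-DEPTH `valued_galAdicCompletionMap_sub_self_le_iff_mem_order` is the conductor-`j(x)` order
  `𝒪_v + ϖ_v^{j(x)} 𝒪_w` (dress `mem_order_iff_exists_of_valued_eq_exp_neg` with `|q| = exp(−j)`).
* (D3) DICTIONARY (docstring only, no import): the TAME self-dual cyclic lattice rows (★ `LocalIrreducibleTorusDiscriminantOdd`, ★ `TypeTwoSelfDualCyclicParity`, mechanism M4 of
  the census) key on the PARITY of `ord disc(γ)` because `d = 1` there: `ord_v disc = 1 + 2j`; at a WILD ramified place the same bookkeeping reads `ord_v disc(γ) ≡ d (mod 2)` and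
  `j(γ) = (ord_v disc(γ) − d)∕2` — the conductor, not the parity, indexes the orders.

## References
* [Serre1979] J.-P. Serre, *Local Fields*, GTM 67 (1979): Ch. III §6 Prop. 11–12 & Cor. 2 (discriminant ∕ different of a monogenic order, `𝔇 = (g′(τ))`), Ch. IV §1 Prop. 4.
* [NeukirchANT1999] J. Neukirch, *Algebraic Number Theory* (1999): Ch. I §12 (orders, conductor `𝒪 + 𝔣𝒪_K`), Ch. III §2 (2.4).
* [Jacobowitz1962] R. Jacobowitz, *Hermitian forms over local fields*, Amer. J. Math. 84 (1962), §§9–11 (ramified dyadic norm∕discriminant bookkeeping).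
-/

set_option autoImplicit false

noncomputable section

open NumberField IsDedekindDomain ValuativeRel
open scoped ValuativeRel WithZero

namespace Literature.NumberTheory.Automorphic.UnitaryGroup

variable (L : Type) [Field L] [NumberField L] [IsCMField L] (v : HeightOneSpectrum (𝓞 ↥(maximalRealSubfield L)))
  (w : PlacesOver L v) (hw : IsCMField.complexConj L • w.1 = w.1) (he : v.asIdeal.ramificationIdx' w.1.asIdeal ≠ 1)

/-! ## §1 (D1) The discriminant of `x = ι p + ι q τ`: `(x − σx)² = ι(q²·(u₀² + 4v₀))`, `ord_v = 2·ord_v q + d` -/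

/-- `x − σx = ι q · (τ − στ)` for `x = ι p + ι q τ` (`σ` fixes `ι`). [cite: Serre1979, Ch. IV §1] -/
theorem sub_galAdicCompletionMap_toPlace_add_toPlace_mul (τ : w.1.adicCompletion L) (p q : v.adicCompletion ↥(maximalRealSubfield L)) :
    (toPlace v w p + toPlace v w q * τ) - galAdicCompletionMap (L := L) (IsCMField.complexConj L) hw (toPlace v w p + toPlace v w q * τ) =
      toPlace v w q * (τ - galAdicCompletionMap (L := L) (IsCMField.complexConj L) hw τ) := by
  rw [galAdicCompletionMap_toPlace_add_toPlace_mul L v w hw τ p q]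
  ring

/-- **(D1) THE DISCRIMINANT DESCENDS**: `(x − σx)² = ι(q²·(u₀² + 4v₀))` for `x = ι p + ι q τ`, `τ + στ = ι u₀`, `τ·στ = −ι v₀` (★ `toPlace_trace_sq_add_four_mul_eq`: `(τ − στ)² =
ι(u₀² + 4v₀)`, the discriminant of the Eisenstein polynomial of `τ`). [cite: Serre1979, Ch. III §6 Cor. 2] [cite: NeukirchANT1999, Ch. I §12] -/
theorem sub_galAdicCompletionMap_sq_eq_toPlace {τ : w.1.adicCompletion L} {u₀ v₀ : v.adicCompletion ↥(maximalRealSubfield L)}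
    (htr : τ + galAdicCompletionMap (L := L) (IsCMField.complexConj L) hw τ = toPlace v w u₀)
    (hnm : τ * galAdicCompletionMap (L := L) (IsCMField.complexConj L) hw τ = -toPlace v w v₀) (p q : v.adicCompletion ↥(maximalRealSubfield L)) :
    ((toPlace v w p + toPlace v w q * τ) - galAdicCompletionMap (L := L) (IsCMField.complexConj L) hw (toPlace v w p + toPlace v w q * τ)) ^ 2 =
      toPlace v w (q ^ 2 * (u₀ ^ 2 + 4 * v₀)) := by
  rw [sub_galAdicCompletionMap_toPlace_add_toPlace_mul L v w hw τ p q, mul_pow, map_mul, map_pow, toPlace_trace_sq_add_four_mul_eq L v w hw htr hnm, pow_two,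
    pow_two]

include he in
/-- **(D1) `|(x − σx)²|_w = |q|_v⁴ · |στ − τ|_w²`** for `x = ι p + ι q τ` (`|ι q|_w = |q|_v²`). [cite: Serre1979, Ch. IV §1 Prop. 4] -/
theorem valued_sub_galAdicCompletionMap_sq (τ : w.1.adicCompletion L) (p q : v.adicCompletion ↥(maximalRealSubfield L)) :
    Valued.v (((toPlace v w p + toPlace v w q * τ) - galAdicCompletionMap (L := L) (IsCMField.complexConj L) hw (toPlace v w p + toPlace v w q * τ)) ^ 2) =
      Valued.v q ^ 4 * Valued.v (galAdicCompletionMap (L := L) (IsCMField.complexConj L) hw τ - τ) ^ 2 := by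
  rw [sub_galAdicCompletionMap_toPlace_add_toPlace_mul L v w hw τ p q, map_pow, map_mul, valued_toPlace_eq_sq_of_ramified L v w hw he, Valuation.map_sub_swap, mul_pow,
    ← pow_mul]

include he in
/-- **THE DIFFERENT NUMBER IN `L⁺_v`-LETTERS**: `|u₀² + 4v₀|_v = |στ − τ|_w` (both valuations normalised; from `ι(u₀² + 4v₀) = (τ − στ)²` and `|ι y|_w = |y|_v²`, squares cancel in `ℤᵐ⁰`).
This is the `d` of ★ FILE 2 read as the `v`-normalised discriminant exponent of `L_w ∕ L⁺_v`. [cite: Serre1979, Ch. III §6 Cor. 2, Ch. IV §1 Prop. 4] -/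
theorem valued_trace_sq_add_four_mul {τ : w.1.adicCompletion L} {u₀ v₀ : v.adicCompletion ↥(maximalRealSubfield L)}
    (htr : τ + galAdicCompletionMap (L := L) (IsCMField.complexConj L) hw τ = toPlace v w u₀)
    (hnm : τ * galAdicCompletionMap (L := L) (IsCMField.complexConj L) hw τ = -toPlace v w v₀) :
    Valued.v (u₀ ^ 2 + 4 * v₀) = Valued.v (galAdicCompletionMap (L := L) (IsCMField.complexConj L) hw τ - τ) := by
  apply eq_of_sq_eq_sq
  rw [← valued_toPlace_eq_sq_of_ramified L v w hw he, toPlace_trace_sq_add_four_mul_eq L v w hw htr hnm, map_mul, Valuation.map_sub_swap, pow_two]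

include he in
/-- **(D1) «ord_v disc(x) = 2·j(x) + d»**: for a uniformiser `τ` and `x = ι p + ι q τ` there is `δ ∈ L⁺_v` with `ι δ = (x − σx)²` and `|δ|_v = |q|_v² · |στ − τ|_w` (mixed
normalisations as in ★ FILE 2: `|στ − τ|_w = exp(−d)` read as the `v`-adic `exp(−d)`).  `δ = q²·(u₀² + 4v₀)` for the Eisenstein data of `τ`.
[cite: Serre1979, Ch. III §6 Cor. 2] [cite: NeukirchANT1999, Ch. I §12] -/
theorem exists_toPlace_eq_sub_galAdicCompletionMap_sq {τ : w.1.adicCompletion L} (hτ : Valued.v τ = WithZero.exp (-1 : ℤ))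
    (p q : v.adicCompletion ↥(maximalRealSubfield L)) :
    ∃ δ : v.adicCompletion ↥(maximalRealSubfield L),
      toPlace v w δ = ((toPlace v w p + toPlace v w q * τ) - galAdicCompletionMap (L := L) (IsCMField.complexConj L) hw (toPlace v w p + toPlace v w q * τ)) ^ 2 ∧
        Valued.v δ = Valued.v q ^ 2 * Valued.v (galAdicCompletionMap (L := L) (IsCMField.complexConj L) hw τ - τ) := by
  obtain ⟨u₀, v₀, htr, hnm, -, -⟩ := exists_eisenstein_coeffs_of_ramified L v w hw he hτ
  exact ⟨q ^ 2 * (u₀ ^ 2 + 4 * v₀), (sub_galAdicCompletionMap_sq_eq_toPlace L v w hw htr hnm p q).symm,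
    by rw [map_mul, map_pow, valued_trace_sq_add_four_mul L v w hw he htr hnm]⟩

include he in
/-- **(D1) IN CONDUCTOR LETTERS**: if `|q|_v = exp(−j)` (conductor `j`) and `|στ − τ|_w = exp(−d)` then `ι δ = (x − σx)²` with `|δ|_v = exp(−(d + 2j))` — `ord_v disc(x) = d + 2·j(x)`.
[cite: Serre1979, Ch. III §6 Cor. 2] [cite: NeukirchANT1999, Ch. I §12] -/
theorem exists_toPlace_eq_sub_galAdicCompletionMap_sq_of_valued_eq_exp_neg {τ : w.1.adicCompletion L} (hτ : Valued.v τ = WithZero.exp (-1 : ℤ))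
    {d j : ℕ} (hd : Valued.v (galAdicCompletionMap (L := L) (IsCMField.complexConj L) hw τ - τ) = WithZero.exp (-(d : ℤ)))
    (p : v.adicCompletion ↥(maximalRealSubfield L)) {q : v.adicCompletion ↥(maximalRealSubfield L)} (hq : Valued.v q = WithZero.exp (-(j : ℤ))) :
    ∃ δ : v.adicCompletion ↥(maximalRealSubfield L),
      toPlace v w δ = ((toPlace v w p + toPlace v w q * τ) - galAdicCompletionMap (L := L) (IsCMField.complexConj L) hw (toPlace v w p + toPlace v w q * τ)) ^ 2 ∧
        Valued.v δ = WithZero.exp (-((d : ℤ) + 2 * j)) := by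
  obtain ⟨δ, hδ, hv⟩ := exists_toPlace_eq_sub_galAdicCompletionMap_sq L v w hw he hτ p q
  refine ⟨δ, hδ, ?_⟩
  rw [hv, hq, hd, ← WithZero.exp_nsmul, ← WithZero.exp_add]
  congr 1
  simp only [nsmul_eq_mul, Nat.cast_ofNat]
  ring

/-! ## §2 (D2) `𝒪_v[x]` is the σ-depth ball `|q|²·D` of `𝒪_w` — the conductor-`j(x)` order -/

include hw he in
/-- **(D2) THE MONOGENIC ORDER `𝒪_v[x]` IS THE CONDUCTOR-`j(x)` ORDER**: for a uniformiser `τ` and an integral `x = ι p + ι q τ` (`|p|, |q| ≤ 1`), an element `y ∈ L_w` lies in `𝒪_v[x]`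
(`y = ι a + ι b·x` with `a, b ∈ 𝒪_v`) iff `|y| ≤ 1` and `|σy − y| ≤ |q|²·|στ − τ|`.  (→: `ι a + ι b·x = ι(a + bp) + ι(bq)·τ` has `τ`-coordinate `bq`; ←: write `y = ι a′ + ι b′ τ`
(★ basis); the depth bound is `|b′| ≤ |q|` (★ σ-DEPTH), so `b′ = q·b` with `b ∈ 𝒪_v` and `y = ι(a′ − bp) + ι b·x`.)  With ★ `valued_galAdicCompletionMap_sub_self_le_iff_mem_order`:
`𝒪_v[x] = 𝒪_v + ϖ_v^{ord_v q} 𝒪_w`. [cite: NeukirchANT1999, Ch. I §12] [cite: Serre1979, Ch. III §6 Prop. 11] -/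
theorem mem_order_iff_valued_galAdicCompletionMap_sub_self_le {τ : w.1.adicCompletion L} (hτ : Valued.v τ = WithZero.exp (-1 : ℤ))
    {p q : v.adicCompletion ↥(maximalRealSubfield L)} (hp : Valued.v p ≤ 1) (hq : Valued.v q ≤ 1) (y : w.1.adicCompletion L) :
    (∃ a b : v.adicCompletion ↥(maximalRealSubfield L), Valued.v a ≤ 1 ∧ Valued.v b ≤ 1 ∧ y = toPlace v w a + toPlace v w b * (toPlace v w p + toPlace v w q * τ)) ↔
      (Valued.v y ≤ 1 ∧ Valued.v (galAdicCompletionMap (L := L) (IsCMField.complexConj L) hw y - y) ≤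
        Valued.v q ^ 2 * Valued.v (galAdicCompletionMap (L := L) (IsCMField.complexConj L) hw τ - τ)) := by
  -- the coordinates of `ι a + ι b·x` in the basis `(1, τ)`
  have hcoord : ∀ a b : v.adicCompletion ↥(maximalRealSubfield L),
      toPlace v w a + toPlace v w b * (toPlace v w p + toPlace v w q * τ) = toPlace v w (a + b * p) + toPlace v w (b * q) * τ := by
    intro a b; rw [map_add, map_mul, map_mul]; ring
  constructor
  · rintro ⟨a, b, ha, hb, rfl⟩
    rw [hcoord]
    refine ⟨?_, ?_⟩
    · rw [v_le_one_iff_mem_integer, toPlace_add_toPlace_mul_mem_integer_iff L v w hw he hτ, ← v_le_one_iff_mem_integer, ← v_le_one_iff_mem_integer]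
      exact ⟨Valuation.map_add_le _ ha (by rw [map_mul]; exact mul_le_one' hb hp), by rw [map_mul]; exact mul_le_one' hb hq⟩
    · rw [valued_galAdicCompletionMap_sub_self_le_sq_mul_iff L v w hw he hτ, map_mul]
      calc Valued.v b * Valued.v q ≤ 1 * Valued.v q := mul_le_mul_left hb _
        _ = Valued.v q := one_mul _
  · rintro ⟨hy1, hyσ⟩
    obtain ⟨a', b', rfl⟩ := exists_eq_toPlace_add_toPlace_mul L v w hw he hτ y
    obtain ⟨ha', hb'⟩ := (toPlace_add_toPlace_mul_mem_integer_iff L v w hw he hτ a' b').1 ((v_le_one_iff_mem_integer _).1 hy1)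
    rw [← v_le_one_iff_mem_integer] at ha' hb'
    have hb'q : Valued.v b' ≤ Valued.v q := (valued_galAdicCompletionMap_sub_self_le_sq_mul_iff L v w hw he hτ a' b' (Valued.v q)).1 hyσ
    rcases eq_or_ne q 0 with hq0 | hq0
    · -- `q = 0`: `x = ι p`, the order is `ι 𝒪_v`, and `b′ = 0`
      have hb0 : b' = 0 := by
        rw [hq0, map_zero, le_zero_iff] at hb'q
        exact (Valuation.zero_iff _).1 hb'q
      refine ⟨a', 0, ha', by rw [map_zero]; exact zero_le, ?_⟩
      rw [hb0, hq0, map_zero]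
      ring
    · -- `q ≠ 0`: `b := b′ ∕ q ∈ 𝒪_v`, `a := a′ − b·p`
      refine ⟨a' - b' / q * p, b' / q, ?_, ?_, ?_⟩
      · refine Valuation.map_sub_le _ ha' ?_
        rw [map_mul, map_div₀]
        exact mul_le_one' ((div_le_one₀ ((Valuation.pos_iff _).2 hq0)).2 hb'q) hp
      · rw [map_div₀]; exact (div_le_one₀ ((Valuation.pos_iff _).2 hq0)).2 hb'q
      · rw [hcoord, sub_add_cancel, div_mul_cancel₀ b' hq0]

include hw he in
/-- **(D2) IN CONDUCTOR LETTERS**: if `|q|_v = exp(−j)` then `y ∈ 𝒪_v[x] ↔ |y| ≤ 1 ∧ |σy − y| ≤ exp(−2j)·|στ − τ|` — the letters of ★ σ-DEPTH `valued_galAdicCompletionMap_sub_self_le_iff_mem_order`,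
so `𝒪_v[x] = 𝒪_v + ϖ_v^j 𝒪_w`, the conductor-`j` order. [cite: NeukirchANT1999, Ch. I §12] -/
theorem mem_order_iff_of_valued_eq_exp_neg {τ : w.1.adicCompletion L} (hτ : Valued.v τ = WithZero.exp (-1 : ℤ))
    {p q : v.adicCompletion ↥(maximalRealSubfield L)} (hp : Valued.v p ≤ 1) {j : ℕ} (hq : Valued.v q = WithZero.exp (-(j : ℤ))) (y : w.1.adicCompletion L) :
    (∃ a b : v.adicCompletion ↥(maximalRealSubfield L), Valued.v a ≤ 1 ∧ Valued.v b ≤ 1 ∧ y = toPlace v w a + toPlace v w b * (toPlace v w p + toPlace v w q * τ)) ↔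
      (Valued.v y ≤ 1 ∧ Valued.v (galAdicCompletionMap (L := L) (IsCMField.complexConj L) hw y - y) ≤
        WithZero.exp (-(2 * j : ℤ)) * Valued.v (galAdicCompletionMap (L := L) (IsCMField.complexConj L) hw τ - τ)) := by
  have hq1 : Valued.v q ≤ 1 := by rw [hq, ← WithZero.exp_zero, WithZero.exp_le_exp]; omega
  rw [mem_order_iff_valued_galAdicCompletionMap_sub_self_le L v w hw he hτ hp hq1 y, hq, ← WithZero.exp_nsmul]
  simp only [nsmul_eq_mul, Nat.cast_ofNat, mul_neg]

end Literature.NumberTheory.Automorphic.UnitaryGroup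

end
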